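import Summits.FinalStateConjecture.FinalStateConjecture.Statement
import Summits.FinalStateConjecture.FinalStateConjecture.Theorems.EIHFluxBalanceInertialRecessionNoHoles
import Literature.Geometry.Lorentzian.FinalEraPackage2
import Literature.Geometry.Lorentzian.CausalityPushUp
import Literature.Geometry.Lorentzian.CausalityOpennessProofs
import HarnessLib

/-!
# Crux `DispersingCapture` (stmt-FinalStateConjecture-17643), line `registered` (birth r2) —
# stub `stub_captureNoHoles` (B₀, the `N = 0` branch)

A rev-2 final era `IsFinalEra₂ 0 M a T δ V C₁ C₂ ρ₀ κ ξ β U₀ B₀ B Ψ₀ Ψ O` with NO hole label, the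
ray clause (R) `RaysStayInClosure 𝒟 O` and the eventual future-orientation (F₀) of the flat chart,
settles in the re-typed Statement's sense. Pure bookkeeping over the package clauses (O), (B),
(F1), (F2), (F3), (EX) of `CauchyDevelopment.IsFinalEra₂`:

* witness: `O' := exteriorOf 𝒟 W`, `W := Ψ₀ '' {x⁰ > T + 1}`, and the hole-free decomposition `d`
  (`d.N = 0`, flat domain `U₀`, flat chart `Ψ₀`, `d.τ₀ = T + 1`; cf.
  `FinalStateDecomposition.ofConvergesToMinkowski` and `inertialRecession_noHoles`);
* `W ⊆ O'` because `W` is open (image of the open late region under the open embedding (F1)) and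
  an open set lies in its own chronological past (`subset_chronologicalPast_of_isOpen`);
* `O' ⊆ O` by monotonicity of `I⁻` (`W ⊆ Ψ₀ '' {x⁰ > T}`), and `O ⊆ O'`: by (EX) at `T + 2` every
  point of `Ψ₀ '' {x⁰ > T}` lies in `W` or in `J⁻(Ψ₀ '' {x⁰ = T + 2}) ⊆ J⁻(W)`, so
  `I⁻(Ψ₀ '' {x⁰ > T}) ⊆ I⁻(J⁻(W)) = I⁻(W)` (push-up, O'Neill's Cor. 14.1,
  `LorentzianMetric.chronologicalFuture_causalFuture_eq_of_boundaryless` read in the reversed time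
  orientation); hence (R) transfers to `O'` (`closure` is monotone);
* the covering clause of `d` and clause (iii) of `HasExhaustiveCharts d` (radii vacuous) are (EX)
  at `T + 1` and at every `τ₁ > T + 1`, transported along `O' ⊆ O`; `tendsto_deviationCk_flat` is
  (F3) (its distance condition over `Fin 0` is vacuous, so its set contains the whole flat slab);
  `IsFutureOriented d` (iii) is (F₀); (i)–(ii) and sub-extremality are vacuous.

References: Christodoulou–Klainerman 1993, Thm. 1.0.2 (the `N = 0` final state); O'Neill 1983,
Ch. 14, Cor. 14.1 and Lemma 14.3; Dafermos–Luk arXiv:1710.01722, Conjecture 1.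
-/

set_option linter.dupNamespace false

noncomputable section

open scoped Manifold ContDiff Topology ENNReal
open Filter Set Function TopologicalSpace Literature.Geometry.Lorentzian

universe u

namespace Summit.FinalStateConjecture.FinalStateConjecture.Theorems.DissipativeFinalMotions.DispersingCapture

section Rays

variable {X : Type} [TopologicalSpace X] [ChartedSpace E3 X] [IsManifold (𝓡 3) ∞ X]
  [ConnectedSpace X] {D : InitialDataSet (𝓡 3) X}

/-- The summit's ray clause `RaysStayInClosure 𝒟 O` is monotone in `O` (`closure` is monotone).
[folklore] -/
private theorem raysStayInClosure_mono (𝒟 : CauchyDevelopment D) {A B : Set 𝒟.carrier}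
    (hAB : A ⊆ B) (h : Summit.FinalStateConjecture.RaysStayInClosure 𝒟 A) :
    Summit.FinalStateConjecture.RaysStayInClosure 𝒟 B := by
  intro _ p γ dom hγ hdom t ht h0
  exact closure_mono hAB (h p γ dom hγ hdom t ht h0)

end Rays

/-- The late regions `{x⁰ > τ}` of the Minkowski background on an open `U ⊆ E4` are open (the time
function `x⁰` is continuous). [folklore] -/
private theorem isOpen_lateRegion_backgroundOn (U : Opens E4) (τ : ℝ) :
    IsOpen ((Minkowski.backgroundOn U).lateRegion τ) :=
  have hc : Continuous (Minkowski.backgroundOn U).time := PiLp.continuous_apply 2 _ 0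
  isOpen_lt continuous_const (hc.comp continuous_subtype_val)

/-- **Restarting a late chart at a later time.** A late chart after `τ₀` into `O` is a late chart
after any `τ₁ ≥ τ₀` into any region `O'` containing the image of the late region `{t > τ₁}`,
provided that late region is open (the open embedding restricts along the open inclusion
`{t > τ₁} ↪ {t > τ₀}`). [folklore] -/
private theorem isLateChart_restart {𝓢 : Spacetime.{u} 4} {B : ModelBackground}
    {O O' : Set 𝓢.carrier} {τ₀ τ₁ : ℝ} {Ψ : B.domain → 𝓢.carrier}
    (h : 𝓢.IsLateChart B O τ₀ Ψ) (hτ : τ₀ ≤ τ₁) (hopen : IsOpen (B.lateRegion τ₁))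
    (hO' : Ψ '' B.lateRegion τ₁ ⊆ O') : 𝓢.IsLateChart B O' τ₁ Ψ where
  contMDiff := h.contMDiff
  isOpenEmbedding := h.isOpenEmbedding.comp
    (Topology.IsOpenEmbedding.inclusion (B.lateRegion_mono hτ)
      (hopen.preimage continuous_subtype_val))
  image_subset := hO'

/-- The image of a later (open) late region `{t > τ₁}`, `τ₁ ≥ τ₀`, under a late chart after `τ₀`
is open in the spacetime (range of an open embedding). [folklore] -/
private theorem isOpen_image_lateRegion {𝓢 : Spacetime.{u} 4} {B : ModelBackground}
    {O : Set 𝓢.carrier} {τ₀ τ₁ : ℝ} {Ψ : B.domain → 𝓢.carrier}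
    (h : 𝓢.IsLateChart B O τ₀ Ψ) (hτ : τ₀ ≤ τ₁) (hopen : IsOpen (B.lateRegion τ₁)) :
    IsOpen (Ψ '' B.lateRegion τ₁) := by
  rw [← range_restrict]
  exact (h.isOpenEmbedding.comp (Topology.IsOpenEmbedding.inclusion (B.lateRegion_mono hτ)
    (hopen.preimage continuous_subtype_val))).isOpen_range

/-- A family in `ℝ≥0∞` which is eventually `≤ ENNReal.ofReal ε` for every real `ε > 0` tends to
`0` along `atTop`. [folklore] -/
private theorem tendsto_atTop_zero_of_forall_ofReal {f : ℝ → ℝ≥0∞}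
    (h : ∀ ε : ℝ, 0 < ε → ∃ T' : ℝ, ∀ τ, T' ≤ τ → f τ ≤ ENNReal.ofReal ε) :
    Tendsto f atTop (𝓝 0) := by
  refine ENNReal.tendsto_nhds_zero.2 fun ε hε ↦ ?_
  obtain ⟨ε', hε'0, hε'⟩ : ∃ ε' : ℝ, 0 < ε' ∧ ENNReal.ofReal ε' ≤ ε := by
    rcases eq_or_ne ε ⊤ with htop | htop
    · exact ⟨1, one_pos, htop ▸ le_top⟩
    · exact ⟨ε.toReal, ENNReal.toReal_pos hε.ne' htop, (ENNReal.ofReal_toReal htop).le⟩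
  obtain ⟨T', hT'⟩ := h ε' hε'0
  exact eventually_atTop.2 ⟨T', fun τ hτ ↦ (hT' τ hτ).trans hε'⟩

/-- **B₀ — CAPTURE WITH NO HOLES** (`N = 0` branch of the crux `DispersingCapture`). A rev-2 final
era with NO hole labels — flat chart `Ψ₀` on `U₀ ⊇ {t > T}` ((F2) with a vacuous tube condition),
`C²`-flat on whole late slabs ((F3) with a vacuous distance condition), exhaustion (EX) of
`O = J⁺(ιX) ∩ I⁻(Ψ₀(late T))` by the flat late regions and slabs for every `τ₁ > T`, rays (R) and
flat orientation (F₀) — settles in the re-typed sense: the witness is `d` with `d.N = 0`, flat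
domain `U₀`, flat chart `Ψ₀`, `d.τ₀ = T + 1`, `O' := exteriorOf 𝒟 d.charted =
J⁺(ιX) ∩ I⁻(Ψ₀(late (T+1)))`; `O' = O` by (EX) at `T + 2` and push-up `I⁻(J⁻ W) = I⁻ W`
(`CausalityPushUp`) together with openness of the image `Ψ₀(late (T+1))`, so (R) transfers;
`HasExhaustiveCharts` (radii vacuous) is (EX) at every `τ₁ > T + 1`; `IsFutureOriented` (iii) is
(F₀). Only the development structure is used. Christodoulou–Klainerman 1993, Thm. 1.0.2 (the
`N = 0` final state); O'Neill 1983, Ch. 14, Cor. 14.1; Dafermos–Luk arXiv:1710.01722, Conj. 1. -/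
theorem stub_captureNoHoles : open scoped Manifold Topology in ∀ (X : Type) [TopologicalSpace X] [ChartedSpace (EuclideanSpace ℝ (Fin 3)) X] [IsManifold (𝓡 3) ((⊤ : ℕ∞) : WithTop ℕ∞) X] [T2Space X] [SecondCountableTopology X] [ConnectedSpace X], ∀ (D : Literature.Geometry.Lorentzian.InitialDataSet (𝓡 3) X) (𝒟 : Literature.Geometry.Lorentzian.VacuumCauchyDevelopment D) (M a : Fin 0 → ℝ) (T δ V C₁ C₂ ρ₀ κ : ℝ) (ξ : Fin 0 → ℝ → EuclideanSpace ℝ (Fin 3)) (β : ℝ → ℝ) (U₀ : TopologicalSpace.Opens Literature.Geometry.Lorentzian.E4) (B₀ : Literature.Geometry.Lorentzian.ModelBackground) (B : Fin 0 → Literature.Geometry.Lorentzian.ModelBackground) (Ψ₀ : B₀.domain → 𝒟.carrier) (Ψ : (i : Fin 0) → (B i).domain → 𝒟.carrier) (O : Set 𝒟.carrier), 𝒟.toCauchyDevelopment.IsFinalEra₂ 0 M a T δ V C₁ C₂ ρ₀ κ ξ β U₀ B₀ B Ψ₀ Ψ O → Summit.FinalStateConjecture.RaysStayInClosure 𝒟.toCauchyDevelopment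 O → (∃ ϱ₀ : ℝ, ∀ᶠ τ in Filter.atTop, ∀ x ∈ B₀.timeSlab τ, (∀ i, ϱ₀ ≤ ‖Literature.Geometry.Lorentzian.E4.spatial x.1 - ξ i τ‖) → 𝒟.toSpacetime.timeOrientation.IsFutureDirected (mfderiv 𝓘(ℝ, Literature.Geometry.Lorentzian.E4) (𝓡 4) Ψ₀ x (Literature.Geometry.Lorentzian.E4.basisVector 0))) → ∃ (O' : Set 𝒟.carrier) (d : Literature.Geometry.Lorentzian.FinalStateDecomposition 𝒟.toSpacetime O' 2), (∀ i, Literature.Geometry.Lorentzian.Kerr.IsSubextremal (d.mass i) (d.spin i)) ∧ O' = Summit.FinalStateConjecture.exteriorOf 𝒟.toCauchyDevelopment d.charted ∧ Summit.FinalStateConjecture.RaysStayInClosure 𝒟.toCauchyDevelopment O' ∧ Summit.FinalStateConjecture.HasExhaustiveCharts d ∧ Summit.FinalStateConjecture.IsFutureOriented d := by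
  intro X _ _ _ _ _ _ D 𝒟 _M _a T _δ _V _C₁ _C₂ ρ₀ _κ ξ _β U₀ B₀ B Ψ₀ Ψ O hera hrays hF₀
  -- the package clauses used: (O), (B) for the flat background, (F1), (F2), (F3), (EX)
  obtain ⟨hO, hB₀, -, -, -, -, -, -, -, -, -, -, -, -, -, -, -, hF1, hF2, hF3, -, -, -, -, -, -, -,
    -, hEX, -, -⟩ := hera
  subst hB₀
  -- no hole label: the unions over `Fin 0` are empty, the conditions over `Fin 0` vacuous
  rw [iUnion_of_empty, union_empty] at hO
  have hEX' : ∀ τ₁, T < τ₁ → O \ Ψ₀ '' (Minkowski.backgroundOn U₀).lateRegion τ₁ ⊆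
      𝒟.metric.causalPast 𝒟.timeOrientation
        (Ψ₀ '' (Minkowski.backgroundOn U₀).timeSlab τ₁) := by
    intro τ₁ hτ₁
    have h := hEX τ₁ hτ₁
    rwa [iUnion_of_empty, union_empty, iUnion_of_empty, union_empty] at h
  have hU : ∀ x : E4, T < x 0 → x ∈ (U₀ : Set E4) := fun x hx ↦ @hF2 x ⟨hx, fun i ↦ i.elim0⟩
  obtain ⟨ϱ₀, hF₀⟩ := hF₀
  have hF₀' : ∀ᶠ τ in atTop, ∀ x ∈ (Minkowski.backgroundOn U₀).timeSlab τ,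
      𝒟.toSpacetime.timeOrientation.IsFutureDirected
        (mfderiv 𝓘(ℝ, E4) (𝓡 4) Ψ₀ x (E4.basisVector 0)) :=
    hF₀.mono fun τ hτ x hx ↦ hτ x hx fun i ↦ i.elim0
  -- (F3): `C²` flatness on the whole flat slabs `{x⁰ = τ} ∩ U₀`
  have hflat : Tendsto (fun τ ↦ 𝒟.toSpacetime.deviationCk (Minkowski.backgroundOn U₀) Ψ₀ 2 τ)
      atTop (𝓝 0) := by
    refine tendsto_atTop_zero_of_forall_ofReal fun ε hε ↦ ?_
    obtain ⟨ϱ, T', hT'⟩ := hF3 ε hε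
    refine ⟨T', fun τ hτ ↦ ?_⟩
    have hsub : (Minkowski.backgroundOn U₀).timeSlab τ ⊆
        {y : (Minkowski.backgroundOn U₀).domain |
          y.1 0 = τ ∧ ∀ i : Fin 0, ϱ ≤ ‖E4.spatial y.1 - ξ i τ‖} :=
      fun y hy ↦ ⟨hy, fun i ↦ i.elim0⟩
    exact (supCkENorm_mono (image_mono hsub) _ _).trans (hT' τ hτ)
  have h1 : T ≤ T + 1 := (lt_add_one T).le
  -- the restarted late image `W = Ψ₀ '' {x⁰ > T + 1}` is open and lies in `Ψ₀ '' {x⁰ > T} ⊆ O`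
  have hWopen : IsOpen (Ψ₀ '' (Minkowski.backgroundOn U₀).lateRegion (T + 1)) :=
    isOpen_image_lateRegion hF1 h1 (isOpen_lateRegion_backgroundOn U₀ _)
  have hWsub : Ψ₀ '' (Minkowski.backgroundOn U₀).lateRegion (T + 1) ⊆
      Ψ₀ '' (Minkowski.backgroundOn U₀).lateRegion T :=
    image_mono ((Minkowski.backgroundOn U₀).lateRegion_mono h1)
  have hWO : Ψ₀ '' (Minkowski.backgroundOn U₀).lateRegion (T + 1) ⊆ O :=
    hWsub.trans hF1.image_subset
  have hOJ : O ⊆ 𝒟.metric.causalFuture 𝒟.timeOrientation (range 𝒟.embed) := by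
    rw [hO]
    exact inter_subset_left
  -- the new region `O' = J⁺(ι X) ∩ I⁻(W)`
  let O' : Set 𝒟.carrier := Summit.FinalStateConjecture.exteriorOf 𝒟.toCauchyDevelopment
    (Ψ₀ '' (Minkowski.backgroundOn U₀).lateRegion (T + 1))
  have hO'O : O' ⊆ O := by
    rw [hO]
    exact inter_subset_inter_right _ (LorentzianMetric.chronologicalFuture_mono hWsub)
  have hWO' : Ψ₀ '' (Minkowski.backgroundOn U₀).lateRegion (T + 1) ⊆ O' :=
    subset_inter (hWO.trans hOJ)
      (subset_chronologicalPast_of_isOpen 𝒟.metric 𝒟.timeOrientation hWopen)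
  -- `Ψ₀ '' {x⁰ > T} ⊆ J⁻(W)`, by (EX) at `T + 2`
  have hlateJ : Ψ₀ '' (Minkowski.backgroundOn U₀).lateRegion T ⊆
      𝒟.metric.causalPast 𝒟.timeOrientation
        (Ψ₀ '' (Minkowski.backgroundOn U₀).lateRegion (T + 1)) := by
    intro q hq
    by_cases hq2 : q ∈ Ψ₀ '' (Minkowski.backgroundOn U₀).lateRegion (T + 2)
    · exact LorentzianMetric.subset_causalPast 𝒟.metric 𝒟.timeOrientation _
        (image_mono ((Minkowski.backgroundOn U₀).lateRegion_mono (by linarith)) hq2)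
    · exact LorentzianMetric.causalFuture_mono (τ := 𝒟.timeOrientation.reverse)
        (image_mono ((Minkowski.backgroundOn U₀).timeSlab_subset_lateRegion (by linarith)))
        (hEX' (T + 2) (by linarith) ⟨hF1.image_subset hq, hq2⟩)
  -- `O ⊆ O'`: `I⁻(Ψ₀ '' {x⁰ > T}) ⊆ I⁻(J⁻(W)) = I⁻(W)` (push-up, O'Neill's Cor. 14.1)
  have hOO' : O ⊆ O' := by
    intro p hp
    rw [hO] at hp
    refine ⟨hp.1, ?_⟩
    have h2 := LorentzianMetric.chronologicalFuture_mono (τ := 𝒟.timeOrientation.reverse)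
      hlateJ hp.2
    exact (LorentzianMetric.chronologicalFuture_causalFuture_eq_of_boundaryless
      (τ := 𝒟.timeOrientation.reverse) (by exact_mod_cast le_top)
      (Ψ₀ '' (Minkowski.backgroundOn U₀).lateRegion (T + 1))).subset h2
  -- the ray clause transfers to `O' ⊇ O`
  have hrays' : Summit.FinalStateConjecture.RaysStayInClosure 𝒟.toCauchyDevelopment O' :=
    raysStayInClosure_mono 𝒟.toCauchyDevelopment hOO' hrays
  -- the decomposition with no hole: flat chart `Ψ₀` on `U₀`, started at `T + 1`
  let d : FinalStateDecomposition 𝒟.toSpacetime O' 2 :=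
    { N := 0
      mass := Fin.elim0
      spin := Fin.elim0
      mass_pos := fun i ↦ i.elim0
      abs_spin_le_mass := fun i ↦ i.elim0
      motion := Fin.elim0
      τ₀ := T + 1
      chart := fun i ↦ i.elim0
      isLateChart := fun i ↦ i.elim0
      tendsto_truncDeviationCk := fun i ↦ i.elim0
      exists_pairwise_disjoint := fun _ ↦ ⟨0, fun i ↦ i.elim0⟩
      excision := Fin.elim0
      tendsto_excision_div := fun i ↦ i.elim0
      flatDomain := U₀
      setOf_lt_excision_subset_flatDomain := fun x hx ↦ hU x ((lt_add_one T).trans hx.1)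
      flatChart := Ψ₀
      isLateChart_flat :=
        isLateChart_restart hF1 h1 (isOpen_lateRegion_backgroundOn U₀ _) hWO'
      tendsto_deviationCk_flat := hflat
      diff_subset_causalPast := by
        intro p hp
        have hp2 : p ∉ Ψ₀ '' (Minkowski.backgroundOn U₀).lateRegion (T + 1) := fun h' ↦
          hp.2 (Or.inr h')
        exact LorentzianMetric.causalFuture_mono subset_union_right
          (hEX' (T + 1) (lt_add_one T) ⟨hO'O hp.1, hp2⟩) }
  refine ⟨O', d, fun i ↦ i.elim0, ?_, hrays', ⟨fun i ↦ i.elim0, fun i ↦ i.elim0,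
    fun i ↦ i.elim0, fun τ₁ hτ₁ ↦ ?_⟩, fun i ↦ i.elim0, fun i ↦ i.elim0, hF₀'⟩
  · -- `O' = J⁺(ι X) ∩ I⁻(d.charted)`: `d.charted = W`
    have hch : d.charted = Ψ₀ '' (Minkowski.backgroundOn U₀).lateRegion (T + 1) := by
      ext p
      simp only [FinalStateDecomposition.charted, mem_union, mem_iUnion]
      constructor
      · rintro (h' | ⟨i, -⟩)
        · exact h'
        · exact i.elim0
      · exact fun h' ↦ Or.inl h'
    rw [hch]
  · -- exhaustion at chart time `τ₁ > T + 1`: (EX) at `τ₁`, transported along `O' ⊆ O`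
    intro p hp
    have hτ : T < τ₁ := by
      have hτ' : T + 1 < τ₁ := hτ₁
      linarith
    have hp2 : p ∉ Ψ₀ '' (Minkowski.backgroundOn U₀).lateRegion τ₁ := fun h' ↦ hp.2 (Or.inl h')
    exact LorentzianMetric.causalFuture_mono subset_union_left (hEX' τ₁ hτ ⟨hO'O hp.1, hp2⟩)

end Summit.FinalStateConjecture.FinalStateConjecture.Theorems.DissipativeFinalMotions.DispersingCapture

end
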